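import Literature.MathematicalPhysics.QuantumManyBody.PeriodicFeynmanKacEnergyLower
import HarnessLib

/-!
# Route `BECGroundStateSOS`, crux `PeriodicIRBound` (stmt-AtomisticToContinuum-3972),
# line `linear-ph-floor-wagner` — stub S-A `stub_fkFormUpperBoundIntegrable`, part 1 (lemmas)

Small-time FORM UPPER BOUND of the torus Feynman–Kac pairing (Chung–Zhao (1995), Prop 3.29) for a
real periodic `C¹` function `ψ` when the periodic interaction
`V^per = periodicInteraction v L = ∑_{i<j} v^per(xᵢ - xⱼ)` is only INTEGRABLE on the fundamental
cell (`∫_cell V^per < ∞`), not bounded: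
`‖ψ‖²_cell − ⟨ψ, e^{-tH}ψ⟩_cell ≤ t · (∫_cell |∇ψ|² + ∫_cell V^per ψ² + ε)` for `0 < t < t₀(ε)`
(the theorem itself is in the sequel file `…PFFormUpperBound2.lean`).

This is the integrable twin of `form_upper_bound_periodic`
(`Literature/…/PeriodicFeynmanKacEnergyLower.lean`, bounded periodisation). The boundedness of
`v^per` was used there only (a) to make the action `A = ∫₀ᵗ V^per(B_s) ds` finite, so that the
weight defect `1 - e^{-A} ≤ A` can be written in `ℝ`, and (b) to bound the Lipschitz remainders by
`sup V^per`. This file supplies the replacements: (a) the truncated defect `1 - w_t ≤ min(A, 1)`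
(`w_t = 0` when `A = ∞`) and the resulting pairing lower bound `pairing_lower_bound_min` for any
measurable `v`; (b) TRANSLATION INVARIANCE of cell integrals of periodic functions
(`lintegral_cellN_comp_add`): `∫_cell ψ(X)² V^per(X + h) dX ≤ ∫_cell ψ² V^per + 2MG‖h‖ ∫_cell V^per`
(`setLIntegral_cellN_sq_mul_shift_le_of_bound`) and
`∫_cell dX ∫₀ᵗ V^per(X + √2 b_s) ds = t ∫_cell V^per` (`setLIntegral_cellN_periodicPathAction_eq`);
and the finiteness of the cell kinetic energy of a periodic `C¹` function.

## References

* K. L. Chung, Z. Zhao, *From Brownian Motion to Schrödinger's Equation* (1995), Thm 3.27,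
  Prop 3.29 (81). [ChungZhao1995]
-/

noncomputable section

open scoped BigOperators ENNReal NNReal
open Filter MeasureTheory ProbabilityTheory Set

namespace Summit.AtomisticToContinuum.BoseEinsteinCondensation.Cruxes.PeriodicIRBound.LinearPhFloorWagner

open Literature.MathematicalPhysics.QuantumManyBody
open Literature.MathematicalPhysics.QuantumManyBody.BoseGas
open Literature.Probability.Process

variable {N : ℕ}

/-! ### Finiteness of the cell kinetic energy of a periodic `C¹` function -/

/-- **The cell kinetic energy of a periodic `C¹` function is finite**: its gradient is continuous
and periodic, hence bounded, and the cell has finite volume. [folklore] -/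
theorem setLIntegral_cellN_realKinetic_ne_top {L : ℝ} (hL : 0 < L) {ψ : Config N → ℝ}
    (hψ : ContDiff ℝ 1 ψ)
    (hper : ∀ (X : Config N) (i : Fin N) (k : Fin 3),
      ψ (X + Pi.single i (EuclideanSpace.single k L)) = ψ X) :
    ∫⁻ X in cellN N L, realKinetic ψ X ≠ ⊤ := by
  set r : Config N → ℝ := fun X =>
    ∑ i, ∑ k, (fderiv ℝ ψ X (Pi.single i (EuclideanSpace.single k (1 : ℝ)))) ^ 2 with hr
  have hrc : Continuous r := by
    refine continuous_finsetSum _ fun i _ => continuous_finsetSum _ fun k _ => ?_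
    exact ((hψ.continuous_fderiv one_ne_zero).clm_apply continuous_const).pow 2
  have hrper : ∀ (X : Config N) (i : Fin N) (k : Fin 3),
      r (X + Pi.single i (EuclideanSpace.single k L)) = r X := fun X i k => by
    simp only [hr, fderiv_periodic hper]
  obtain ⟨M, -, hM⟩ := exists_bound_of_continuous_periodic hL hrc hrper
  have hle : ∫⁻ X in cellN N L, realKinetic ψ X ≤ ENNReal.ofReal M * volume (cellN N L) :=
    calc ∫⁻ X in cellN N L, realKinetic ψ X ≤ ∫⁻ _X in cellN N L, ENNReal.ofReal M :=
          setLIntegral_mono measurable_const fun X _ => by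
            rw [realKinetic_eq_ofReal]
            exact ENNReal.ofReal_le_ofReal ((le_abs_self _).trans (hM X))
      _ = ENNReal.ofReal M * volume (cellN N L) := setLIntegral_const _ _
  exact ne_top_of_le_ne_top
    (ENNReal.mul_ne_top ENNReal.ofReal_ne_top (volume_cellN_ne_top N L)) hle

/-! ### The truncated weight defect and the pairing lower bound -/

/-- **Weight defect without boundedness**: `1 - w_t ≤ min(∫₀ᵗ V^per(B_s) ds, 1)` (`e^{-a} ≥ 1 - a`,
`e^{-a} > 0`, and `w_t = 0` when the action is infinite). [folklore] -/
theorem one_sub_periodicWeight_le_min (v : ℝ → ℝ≥0∞) (L t : ℝ) (X : Config N) (ω : PathSpace N) :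
    1 - (periodicFKWeight v L t X ω).toReal ≤ (min (periodicPathAction v L t X ω) 1).toReal := by
  by_cases hA : periodicPathAction v L t X ω = ⊤
  · rw [(periodicFKWeight_eq_zero_iff v L t X ω).2 hA, hA, min_eq_right le_top]
    simp
  · have hw : (periodicFKWeight v L t X ω).toReal =
        Real.exp (-(periodicPathAction v L t X ω).toReal) := by
      rw [periodicFKWeight, expNeg, if_neg hA, ENNReal.toReal_ofReal (Real.exp_pos _).le]
    rw [hw]
    rcases le_total (periodicPathAction v L t X ω) 1 with h1 | h1
    · rw [min_eq_left h1]
      have := Real.add_one_le_exp (-(periodicPathAction v L t X ω).toReal)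
      linarith
    · rw [min_eq_right h1, ENNReal.toReal_one]
      linarith [Real.exp_pos (-(periodicPathAction v L t X ω).toReal)]

/-- **Pointwise lower bound for the pairing integrand** (no boundedness):
`ψ(X) w ψ(Y) ≥ ψ(X)ψ(Y) - |ψ(X)||ψ(Y)| min(∫₀ᵗ V^per, 1)`. [folklore] -/
theorem pairing_integrand_ge_min (v : ℝ → ℝ≥0∞) (L t : ℝ) (ψ : Config N → ℝ) (X : Config N)
    (ω : PathSpace N) (Y : Config N) :
    ψ X * ψ Y - |ψ X| * |ψ Y| * (min (periodicPathAction v L t X ω) 1).toReal ≤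
      ψ X * ((periodicFKWeight v L t X ω).toReal * ψ Y) := by
  have h1 := one_sub_periodicWeight_le_min v L t X ω
  have hw0 : 0 ≤ (periodicFKWeight v L t X ω).toReal := ENNReal.toReal_nonneg
  have hw1 := toReal_periodicFKWeight_le_one v L t X ω
  set w := (periodicFKWeight v L t X ω).toReal
  set a := ψ X * ψ Y
  have hkey : a - w * a ≤ |a| * (min (periodicPathAction v L t X ω) 1).toReal := by
    calc a - w * a = a * (1 - w) := by ring
      _ ≤ |a| * (1 - w) := mul_le_mul_of_nonneg_right (le_abs_self a) (by linarith)
      _ ≤ _ := mul_le_mul_of_nonneg_left h1 (abs_nonneg a)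
  rw [abs_mul] at hkey
  nlinarith [hkey]

/-- **The pairing lower bound on the torus, general measurable potential**: for a bounded
measurable periodic `ψ` and `t : ℝ≥0`,
`‖ψ‖²_cell - ⟨ψ, e^{-tH}ψ⟩_cell ≤
  sqIncrCell t ψ / 2 + ∫_cell dX E[|ψ(X)| |ψ(B_t)| min(∫₀ᵗ V^per(B_s) ds, 1)]`
(no exit term, no boundedness of the periodised potential). [folklore] -/
theorem pairing_lower_bound_min {v : ℝ → ℝ≥0∞} (hv : Measurable v) {L : ℝ} (hL : 0 < L)
    {ψ : Config N → ℝ} (hψm : Measurable ψ)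
    (hper : ∀ (X : Config N) (i : Fin N) (k : Fin 3),
      ψ (X + Pi.single i (EuclideanSpace.single k L)) = ψ X)
    {M : ℝ} (hM : ∀ X, |ψ X| ≤ M) (t : ℝ≥0) :
    (∫ X in cellN N L, ψ X ^ 2) - ∫ X in cellN N L, ψ X * pfkReal v L t ψ X ≤
      (sqIncrCell L t ψ).toReal / 2 +
      (∫⁻ X in cellN N L, ∫⁻ ω, ‖ψ X‖ₑ * ‖ψ (X + displacement t ω)‖ₑ *
        min (periodicPathAction v L t X ω) 1 ∂wienerPaths N ∂volume).toReal := by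
  have hM0 : 0 ≤ M := (abs_nonneg _).trans (hM 0)
  have hint : Integrable ψ (volume.restrict (cellN N L)) := integrable_cellN_of_bound L hψm hM
  have hψ2 : MemLp ψ 2 (volume.restrict (cellN N L)) := memLp_two_cellN_of_bound L hψm hM
  -- the truncated action is at most `1`
  have hBtop : ∀ (X : Config N) (ω : PathSpace N), min (periodicPathAction v L t X ω) 1 ≠ ⊤ :=
    fun X ω => ne_top_of_le_ne_top ENNReal.one_ne_top (min_le_right _ _)
  have hBreal : ∀ (X : Config N) (ω : PathSpace N),
      (min (periodicPathAction v L t X ω) 1).toReal ≤ 1 := fun X ω =>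
    ENNReal.toReal_le_of_le_ofReal zero_le_one (by rw [ENNReal.ofReal_one]; exact min_le_right _ _)
  have hBm : Measurable fun p : Config N × PathSpace N =>
      min (periodicPathAction v L t p.1 p.2) 1 :=
    (measurable_periodicPathAction_uncurry hv L t).min measurable_const
  -- the world-line at time `t` is `X + displacement t ω`
  have hwl : ∀ (X : Config N) (ω : PathSpace N),
      worldLine X ω ((t : ℝ)).toNNReal = X + displacement t ω := by
    intro X ω; rw [Real.toNNReal_coe]; rfl
  -- notation for the two integrands
  set a : Config N → PathSpace N → ℝ := fun X ω => ψ X * ψ (X + displacement t ω) with ha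
  set b : Config N → PathSpace N → ℝ := fun X ω =>
    |ψ X| * |ψ (X + displacement t ω)| * (min (periodicPathAction v L t X ω) 1).toReal with hb
  -- joint measurability
  have hcompm : Measurable fun p : Config N × PathSpace N => ψ (p.1 + displacement t p.2) :=
    hψm.comp (measurable_fst.add ((measurable_displacement t).comp measurable_snd))
  have ham : Measurable fun p : Config N × PathSpace N => a p.1 p.2 :=
    (hψm.comp measurable_fst).mul hcompm
  have hbm : Measurable fun p : Config N × PathSpace N => b p.1 p.2 :=
    ((hψm.comp measurable_fst).abs.mul hcompm.abs).mul hBm.ennreal_toReal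
  have hwm : Measurable fun p : Config N × PathSpace N =>
      ψ p.1 * ((periodicFKWeight v L t p.1 p.2).toReal * ψ (p.1 + displacement t p.2)) :=
    (hψm.comp measurable_fst).mul
      ((measurable_periodicFKWeight_uncurry hv L t).ennreal_toReal.mul hcompm)
  -- pointwise bounds
  have hab : ∀ X ω, |a X ω| ≤ M * M := fun X ω => by
    simp only [ha, abs_mul]; exact mul_le_mul (hM _) (hM _) (abs_nonneg _) hM0
  have hbb : ∀ X ω, |b X ω| ≤ |ψ X| * M := fun X ω => by
    simp only [hb, abs_mul, abs_abs, abs_of_nonneg ENNReal.toReal_nonneg, mul_assoc]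
    refine mul_le_mul_of_nonneg_left ?_ (abs_nonneg _)
    calc |ψ (X + displacement t ω)| * (min (periodicPathAction v L t X ω) 1).toReal ≤ M * 1 :=
          mul_le_mul (hM _) (hBreal X ω) ENNReal.toReal_nonneg hM0
      _ = M := mul_one M
  have hwb : ∀ X ω, |ψ X * ((periodicFKWeight v L t X ω).toReal * ψ (X + displacement t ω))| ≤
      M * M := by
    intro X ω
    rw [abs_mul, abs_mul, abs_of_nonneg ENNReal.toReal_nonneg]
    calc |ψ X| * ((periodicFKWeight v L t X ω).toReal * |ψ (X + displacement t ω)|)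
        ≤ M * (1 * M) :=
          mul_le_mul (hM _) (mul_le_mul (toReal_periodicFKWeight_le_one _ _ _ _ _) (hM _)
            (abs_nonneg _) zero_le_one) (by positivity) hM0
      _ = M * M := by ring
  -- inner integrability (fixed `X`)
  have hia : ∀ X, Integrable (a X) (wienerPaths N) := fun X =>
    Integrable.of_bound (ham.comp measurable_prodMk_left).aestronglyMeasurable (M * M)
      (Eventually.of_forall fun ω => by rw [Real.norm_eq_abs]; exact hab X ω)
  have hib : ∀ X, Integrable (b X) (wienerPaths N) := fun X =>
    Integrable.of_bound (hbm.comp measurable_prodMk_left).aestronglyMeasurable (|ψ X| * M)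
      (Eventually.of_forall fun ω => by rw [Real.norm_eq_abs]; exact hbb X ω)
  have hiw : ∀ X, Integrable (fun ω => ψ X * ((periodicFKWeight v L t X ω).toReal *
      ψ (X + displacement t ω))) (wienerPaths N) := fun X =>
    Integrable.of_bound (hwm.comp measurable_prodMk_left).aestronglyMeasurable (M * M)
      (Eventually.of_forall fun ω => by rw [Real.norm_eq_abs]; exact hwb X ω)
  -- Step 1: the pairing as a double integral, and the inner lower bound
  have hpair : ∀ X, ψ X * pfkReal v L t ψ X =
      ∫ ω, ψ X * ((periodicFKWeight v L t X ω).toReal * ψ (X + displacement t ω))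
        ∂wienerPaths N := by
    intro X
    rw [pfkReal, ← MeasureTheory.integral_const_mul]
    refine integral_congr_ae (Eventually.of_forall fun ω => ?_)
    simp only [hwl]
  have hinner : ∀ X, (∫ ω, a X ω ∂wienerPaths N) - (∫ ω, b X ω ∂wienerPaths N) ≤
      ψ X * pfkReal v L t ψ X := by
    intro X
    have hiab : Integrable (fun ω => a X ω - b X ω) (wienerPaths N) := (hia X).sub (hib X)
    rw [hpair X, ← integral_sub (hia X) (hib X)]
    refine integral_mono hiab (hiw X) fun ω => ?_
    exact pairing_integrand_ge_min v L _ ψ X ω (X + displacement t ω)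
  -- Step 2: outer integrability (everything is dominated by a multiple of `|ψ X|`)
  have hdom : ∀ (F : Config N → PathSpace N → ℝ) (K : ℝ),
      (Measurable fun p : Config N × PathSpace N => F p.1 p.2) → (∀ X ω, |F X ω| ≤ |ψ X| * K) →
      Integrable (fun X => ∫ ω, F X ω ∂wienerPaths N) (volume.restrict (cellN N L)) := by
    intro F K hFm hFb
    refine Integrable.mono' (hint.norm.mul_const K)
      (hFm.stronglyMeasurable.integral_prod_right' (ν := wienerPaths N)).aestronglyMeasurable
      (Eventually.of_forall fun X => ?_)
    have h := norm_integral_le_of_norm_le_const (μ := wienerPaths N) (C := |ψ X| * K) (f := F X)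
      (Eventually.of_forall fun ω => by rw [Real.norm_eq_abs]; exact hFb X ω)
    rwa [probReal_univ, mul_one, ← Real.norm_eq_abs (ψ X)] at h
  have hIa : Integrable (fun X => ∫ ω, a X ω ∂wienerPaths N) (volume.restrict (cellN N L)) :=
    hdom a M ham fun X ω => by
      simp only [ha, abs_mul]; exact mul_le_mul_of_nonneg_left (hM _) (abs_nonneg _)
  have hIb : Integrable (fun X => ∫ ω, b X ω ∂wienerPaths N) (volume.restrict (cellN N L)) :=
    hdom b _ hbm hbb
  have hIw : Integrable (fun X => ψ X * pfkReal v L t ψ X) (volume.restrict (cellN N L)) := by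
    refine Integrable.mono' (hint.norm.mul_const M)
      (hψm.mul (measurable_pfkReal hv L _ hψm)).aestronglyMeasurable
      (Eventually.of_forall fun X => ?_)
    simp only [norm_mul, Real.norm_eq_abs]
    exact mul_le_mul_of_nonneg_left (abs_pfkReal_le_of_bound v L _ hM X) (abs_nonneg _)
  -- Step 3: integrate the inner bound
  have houter : (∫ X in cellN N L, ∫ ω, a X ω ∂wienerPaths N) -
      (∫ X in cellN N L, ∫ ω, b X ω ∂wienerPaths N) ≤
      ∫ X in cellN N L, ψ X * pfkReal v L t ψ X := by
    rw [← integral_sub hIa hIb]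
    exact integral_mono (hIa.sub hIb) hIw hinner
  -- Step 4: identify the two double integrals
  have hA : ∫ X in cellN N L, ∫ ω, a X ω ∂wienerPaths N =
      (∫ X in cellN N L, ψ X ^ 2) - (sqIncrCell L t ψ).toReal / 2 := by
    rw [← integral_cellN_mul_integral_shift_eq hL hψm hψ2 hper t]
    refine integral_congr_ae (Eventually.of_forall fun X => ?_)
    simp only [ha]
    exact MeasureTheory.integral_const_mul _ _
  have hbof : ∀ X ω, ENNReal.ofReal (b X ω) =
      ‖ψ X‖ₑ * ‖ψ (X + displacement t ω)‖ₑ * min (periodicPathAction v L t X ω) 1 := by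
    intro X ω
    simp only [hb]
    rw [ENNReal.ofReal_mul (by positivity), ENNReal.ofReal_mul (abs_nonneg _),
      ENNReal.ofReal_toReal (hBtop X ω), ← Real.enorm_eq_ofReal_abs, ← Real.enorm_eq_ofReal_abs]
  have hB : ∫ X in cellN N L, ∫ ω, b X ω ∂wienerPaths N =
      (∫⁻ X in cellN N L, ∫⁻ ω, ‖ψ X‖ₑ * ‖ψ (X + displacement t ω)‖ₑ *
        min (periodicPathAction v L t X ω) 1 ∂wienerPaths N ∂volume).toReal := by
    have hin : ∀ X, ∫ ω, b X ω ∂wienerPaths N =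
        (∫⁻ ω, ‖ψ X‖ₑ * ‖ψ (X + displacement t ω)‖ₑ * min (periodicPathAction v L t X ω) 1
          ∂wienerPaths N).toReal := by
      intro X
      have hbX : AEStronglyMeasurable (b X) (wienerPaths N) :=
        (hbm.comp measurable_prodMk_left).aestronglyMeasurable
      have hb0 : 0 ≤ᵐ[wienerPaths N] b X := Eventually.of_forall fun ω => by
        simp only [hb, Pi.zero_apply]
        exact mul_nonneg (mul_nonneg (abs_nonneg _) (abs_nonneg _)) ENNReal.toReal_nonneg
      rw [integral_eq_lintegral_of_nonneg_ae hb0 hbX]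
      simp_rw [hbof]
    simp_rw [hin]
    have hFm : Measurable fun X : Config N => ∫⁻ ω, ‖ψ X‖ₑ * ‖ψ (X + displacement t ω)‖ₑ *
        min (periodicPathAction v L t X ω) 1 ∂wienerPaths N := by
      have : Measurable fun p : Config N × PathSpace N => ENNReal.ofReal (b p.1 p.2) :=
        ENNReal.measurable_ofReal.comp hbm
      simp_rw [hbof] at this
      exact this.lintegral_prod_right'
    refine integral_toReal hFm.aemeasurable (Eventually.of_forall fun X => ?_)
    calc ∫⁻ ω, ‖ψ X‖ₑ * ‖ψ (X + displacement t ω)‖ₑ * min (periodicPathAction v L t X ω) 1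
          ∂wienerPaths N
        ≤ ∫⁻ _ω, ‖ψ X‖ₑ * ENNReal.ofReal M * 1 ∂wienerPaths N := by
          refine lintegral_mono fun ω => mul_le_mul' (mul_le_mul' le_rfl ?_) (min_le_right _ _)
          rw [Real.enorm_eq_ofReal_abs]; exact ENNReal.ofReal_le_ofReal (hM _)
      _ < ⊤ := by
          rw [lintegral_const, measure_univ, mul_one, mul_one]
          exact ENNReal.mul_lt_top enorm_lt_top ENNReal.ofReal_lt_top
  rw [hA, hB] at houter
  linarith

/-! ### Shift invariance lemmas for the potential term -/

/-- **`L¹(cell)`-Lipschitz continuity of `ψ²` under translation**, weighted by a periodic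
`V ≥ 0`: `∫_cell ψ(X)² V(X + h) dX ≤ ∫_cell ψ² V + G‖h‖ · 2M · ∫_cell V` for a periodic `ψ` with
`|ψ| ≤ M` and Lipschitz constant `G` (shift invariance of the cell integral of the periodic
`Y ↦ ψ(Y - h)² V(Y)`, and `|ψ(Y - h)² - ψ(Y)²| ≤ G‖h‖ · 2M`). [folklore] -/
theorem setLIntegral_cellN_sq_mul_shift_le_of_bound {L : ℝ} (hL : 0 < L) {ψ : Config N → ℝ}
    (hper : ∀ (X : Config N) (i : Fin N) (k : Fin 3),
      ψ (X + Pi.single i (EuclideanSpace.single k L)) = ψ X)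
    {M : ℝ} (hM : ∀ X, |ψ X| ≤ M) {G : ℝ} (hG : 0 ≤ G) (hLip : ∀ Y Z, |ψ Y - ψ Z| ≤ G * ‖Y - Z‖)
    {V : Config N → ℝ≥0∞} (hV : Measurable V)
    (hVper : ∀ (X : Config N) (i : Fin N) (k : Fin 3),
      V (X + Pi.single i (EuclideanSpace.single k L)) = V X) (h : Config N) :
    ∫⁻ X in cellN N L, ENNReal.ofReal (ψ X ^ 2) * V (X + h) ≤
      (∫⁻ X in cellN N L, ENNReal.ofReal (ψ X ^ 2) * V X) +
        ENNReal.ofReal (G * ‖h‖ * (2 * M)) * ∫⁻ X in cellN N L, V X := by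
  have hM0 : 0 ≤ M := (abs_nonneg _).trans (hM 0)
  -- translate (shift invariance of the cell integral of the periodic `Y ↦ ψ(Y-h)² V(Y)`)
  have htr : ∫⁻ X in cellN N L, ENNReal.ofReal (ψ X ^ 2) * V (X + h) =
      ∫⁻ Y in cellN N L, ENNReal.ofReal (ψ (Y - h) ^ 2) * V Y := by
    have := lintegral_cellN_comp_add hL (G := fun Y => ENNReal.ofReal (ψ (Y - h) ^ 2) * V Y)
      (fun Y i k => by simp only [add_sub_right_comm, hper, hVper]) h
    simp only [add_sub_cancel_right] at this
    exact this
  rw [htr]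
  -- pointwise `ψ(Y-h)² ≤ ψ(Y)² + G‖h‖ · 2M`
  have hpt : ∀ Y, ENNReal.ofReal (ψ (Y - h) ^ 2) ≤
      ENNReal.ofReal (ψ Y ^ 2) + ENNReal.ofReal (G * ‖h‖ * (2 * M)) := by
    intro Y
    have hd : |ψ (Y - h) - ψ Y| ≤ G * ‖h‖ := by
      have := hLip (Y - h) Y
      rwa [sub_sub_cancel_left, norm_neg] at this
    have hsq : ψ (Y - h) ^ 2 ≤ ψ Y ^ 2 + G * ‖h‖ * (2 * M) := by
      have h1 : ψ (Y - h) ^ 2 - ψ Y ^ 2 = (ψ (Y - h) - ψ Y) * (ψ (Y - h) + ψ Y) := by ring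
      have h2 : |ψ (Y - h) ^ 2 - ψ Y ^ 2| ≤ G * ‖h‖ * (2 * M) := by
        rw [h1, abs_mul]
        refine mul_le_mul hd ((abs_add_le _ _).trans ?_) (abs_nonneg _) (by positivity)
        linarith [hM (Y - h), hM Y]
      linarith [le_abs_self (ψ (Y - h) ^ 2 - ψ Y ^ 2)]
    calc ENNReal.ofReal (ψ (Y - h) ^ 2)
        ≤ ENNReal.ofReal (ψ Y ^ 2 + G * ‖h‖ * (2 * M)) := ENNReal.ofReal_le_ofReal hsq
      _ = _ := ENNReal.ofReal_add (sq_nonneg _) (by positivity)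
  calc ∫⁻ Y in cellN N L, ENNReal.ofReal (ψ (Y - h) ^ 2) * V Y
      ≤ ∫⁻ Y in cellN N L, (ENNReal.ofReal (ψ Y ^ 2) * V Y +
          ENNReal.ofReal (G * ‖h‖ * (2 * M)) * V Y) := by
        refine lintegral_mono fun Y => ?_
        rw [← add_mul]
        exact mul_le_mul' (hpt Y) le_rfl
    _ = _ := by rw [lintegral_add_right _ (hV.const_mul _), lintegral_const_mul _ hV]

/-- **The cell integral of the periodised action**:
`∫_cell dX ∫₀ᵗ V^per(X + √2 b_s(ω)) ds = t · ∫_cell V^per` for every sample `ω` (Tonelli, and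
shift invariance of the cell integral of the periodic `V^per`). [folklore] -/
theorem setLIntegral_cellN_periodicPathAction_eq {v : ℝ → ℝ≥0∞} (hv : Measurable v) {L : ℝ}
    (hL : 0 < L) (t : ℝ) (ω : PathSpace N) :
    ∫⁻ X in cellN N L, periodicPathAction v L t X ω =
      ENNReal.ofReal t * ∫⁻ X in cellN N L, periodicInteraction v L X := by
  have hVm : Measurable (periodicInteraction (N := N) v L) := measurable_periodicInteraction hv L
  have hm : Measurable fun q : Config N × ℝ =>
      periodicInteraction v L (worldLine q.1 ω q.2.toNNReal) := by
    have h1 : Measurable fun q : Config N × ℝ => worldLine q.1 ω q.2.toNNReal :=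
      measurable_worldLine_prod.comp
        ((measurable_fst.prodMk measurable_const).prodMk measurable_snd)
    exact hVm.comp h1
  unfold periodicPathAction
  rw [lintegral_lintegral_swap hm.aemeasurable]
  have hinner : ∀ s : ℝ, ∫⁻ X in cellN N L, periodicInteraction v L (worldLine X ω s.toNNReal) =
      ∫⁻ X in cellN N L, periodicInteraction v L X := fun s => by
    simp only [worldLine_eq_add_displacement]
    exact lintegral_cellN_comp_add hL (G := periodicInteraction v L)
      (periodicInteraction_add_single v L) (displacement s.toNNReal ω)
  simp_rw [hinner]
  rw [setLIntegral_const, Real.volume_Ioc, sub_zero, mul_comm]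

/-! ### Registered sub-goal of this part -/

/-- **Registered stub of part 1** (`stub_pfPairingLowerBoundMin` on stmt-AtomisticToContinuum-3972):
the pairing lower bound with the truncated action, i.e. `pairing_lower_bound_min` restated
verbatim as the registered sub-goal served by this file. [folklore] -/
theorem stub_pfPairingLowerBoundMin :
    ∀ {N : ℕ} {v : ℝ → ℝ≥0∞}, Measurable v → ∀ {L : ℝ}, 0 < L → ∀ {ψ : Config N → ℝ},
      Measurable ψ →
      (∀ (X : Config N) (i : Fin N) (k : Fin 3),
        ψ (X + Pi.single i (EuclideanSpace.single k L)) = ψ X) →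
      ∀ {M : ℝ}, (∀ X, |ψ X| ≤ M) → ∀ t : ℝ≥0,
        (∫ X in cellN N L, ψ X ^ 2) - ∫ X in cellN N L, ψ X * pfkReal v L t ψ X ≤
          (sqIncrCell L t ψ).toReal / 2 +
          (∫⁻ X in cellN N L, ∫⁻ ω, ‖ψ X‖ₑ * ‖ψ (X + displacement t ω)‖ₑ *
            min (periodicPathAction v L t X ω) 1 ∂wienerPaths N ∂volume).toReal :=
  fun hv _ hL _ hψm hper _ hM t => pairing_lower_bound_min hv hL hψm hper hM t

end Summit.AtomisticToContinuum.BoseEinsteinCondensation.Cruxes.PeriodicIRBound.LinearPhFloorWagner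

end
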